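import Literature.MathematicalPhysics.QuantumFieldTheory.Balaban1983to89.B4Eq19LatticeOperators

/-!
# `Balaban1983to89.B4Eq19LatticeBoxMeans` — T. Bałaban, *Propagators and renormalization transformations for lattice gauge theories. II*,
# Commun. Math. Phys. **96** (1984) 223–250 [Balaban1984PropagatorsII] (1.9) p. 226, with *Propagators for lattice gauge theories in a background
# field*, Commun. Math. Phys. **99** (1985) 389–434 [Balaban1985BackgroundPropagators] Thm 3.1 (3.43)₁∕(3.44) p. 398 (the GRADIENT members
# *«‖ζ∇_UG′(U)λ‖_β»*, *«|(∇_UG′(U)∇\*_Uλ)(x)| ≤ B′₀(ε)(…)»*): **BOX MEANS, CAMPANATO'S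
# MEAN-SQUARE EXCESS ON `ℤ^d` AND LATTICE PATHS** — the vocabulary of the `C^{1,½}` (gradient) interior-regularity files
# `B4Eq19LatticeGradient*` ([Giaquinta1984] Ch. III §3's Campanato scheme, discrete), continuing the `C^{½}` files `B4Eq19Lattice*` of gen 94.

statement-level skeleton of published theorems with citation tags; proofs where landed; nothing here is a claim about the Yang–Mills mass gap

CITATION HEADER (lean-in-tree rule).  Audit cell `pub-balaban`, sub-cell `t4`, BINDER row NE9; filed by NE9 crux-team LEAF PROVER 01
(`b2b-balaban-t4-ne9-formalise-leaf-01`, gen 95; bears_on: R4/N22).  The CONTENT is [folklore] lattice calculus (the discrete analogue of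
[Giaquinta1984] Ch. III §1, §3's set-up: Campanato's mean-square excess); [Balaban1984PropagatorsII] (1.9) ∕ [Balaban1985BackgroundPropagators]
(3.43)₁, (3.44) are the printed statements these files serve, nothing of them is asserted here.

WHAT IS DEFINED (reviewed definitions, elementary and REAL):
* `boxAvg f z ρ = (Σ_{y ∈ Q_ρ(z)} f y) ∕ #Q_ρ(z)` — the mean of `f : ℤ^d → ℝ` over the box `Q_ρ(z) = box z ρ`;
* `exc f z ρ = Σ_{y ∈ Q_ρ(z)} (f y − boxAvg f z ρ)²` — Campanato's mean-square EXCESS (the quantity whose decay `exc ≤ N ρ^{d+2γ}` IS `C^γ`).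
WHAT IS PROVED (sorry-free; [folklore]).
* §1 `sum_sq_sub_eq` (`Σ(f−c)² = exc + #Q·(avg−c)²`), `exc_le_sum_sq_sub` (the mean minimises), `exc_nonneg`, `exc_mono` (in the radius), `exc_add_le`,
  `sq_sub_boxAvg_le_exc`, `card_mul_sq_sub_le_exc` (nested boxes: `#Q′·(avg_{Q′} − avg_Q)² ≤ exc_Q`), `card_mul_boxAvg_sq_le`.
* §2 `abs_sub_le_of_fdiff_bound` — lattice paths: `|v y − v x| ≤ d·ρ·S` on `Q_ρ(x)` when `|∂_νv| ≤ S` on `Q_ρ(x)`.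
HONEST SCOPE.  Definitions + [folklore] lemmas; no estimate of print; NOT summit progress (cell pub-balaban: NE9 NOT PRINTED ∕ NOT PROVED; spine PROVED
0∕9; finite T⁴ — NOT infinite volume, NOT mass gap, NOT BetaPertH, NOT Clay).  NEW file importing `B4Eq19LatticeOperators`.  Net new unproved facts: 0.
-/

noncomputable section

open scoped BigOperators
open Finset

namespace Literature.MathematicalPhysics.QuantumFieldTheory.Balaban1983to89.B4Eq19LatticeBoxMeans

open B4Eq19LatticeOperators

variable {d : ℕ}

/-! ## §1 Box means and the mean-square excess -/

/-- The mean of `f` over the box `Q_ρ(z)` (zero for an empty box). [folklore] [cite: Giaquinta1984, Ch. III §1 p.70] -/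
def boxAvg (f : Zd d → ℝ) (z : Zd d) (ρ : ℤ) : ℝ := (∑ y ∈ box z ρ, f y) / ((box z ρ).card : ℝ)

/-- Campanato's mean-square EXCESS of `f` over `Q_ρ(z)`: `Σ_{y ∈ Q_ρ(z)} (f y − boxAvg f z ρ)²`. [folklore] [cite: Giaquinta1984, Ch. III §1 Def 1.2 p.70] -/
def exc (f : Zd d → ℝ) (z : Zd d) (ρ : ℤ) : ℝ := ∑ y ∈ box z ρ, (f y - boxAvg f z ρ) ^ 2

/-- Unfolding `boxAvg`. [folklore] [cite: Giaquinta1984, Ch. III §1 p.70] -/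
theorem boxAvg_def (f : Zd d → ℝ) (z : Zd d) (ρ : ℤ) : boxAvg f z ρ = (∑ y ∈ box z ρ, f y) / ((box z ρ).card : ℝ) := rfl

/-- Unfolding `exc`. [folklore] [cite: Giaquinta1984, Ch. III §1 p.70] -/
theorem exc_def (f : Zd d → ℝ) (z : Zd d) (ρ : ℤ) : exc f z ρ = ∑ y ∈ box z ρ, (f y - boxAvg f z ρ) ^ 2 := rfl

/-- `exc ≥ 0`. [folklore] [cite: Giaquinta1984, Ch. III §1 p.70] -/
theorem exc_nonneg (f : Zd d → ℝ) (z : Zd d) (ρ : ℤ) : 0 ≤ exc f z ρ := Finset.sum_nonneg fun _ _ => sq_nonneg _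

/-- The defining property of the mean: `Σ_{Q} (f − boxAvg f) = 0`. [folklore] [cite: Giaquinta1984, Ch. III §1 p.70] -/
theorem sum_sub_boxAvg (f : Zd d → ℝ) (z : Zd d) (ρ : ℤ) : ∑ y ∈ box z ρ, (f y - boxAvg f z ρ) = 0 := by
  rw [Finset.sum_sub_distrib, Finset.sum_const, nsmul_eq_mul, boxAvg]
  by_cases hc : ((box z ρ).card : ℝ) = 0
  · have h0 : (box z ρ).card = 0 := by exact_mod_cast hc
    rw [Finset.card_eq_zero.1 h0]; simp
  · rw [mul_div_cancel₀ _ hc, sub_self]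

/-- **`Σ_Q (f − c)² = exc + #Q·(boxAvg f − c)²`** for every constant `c`. [folklore] [cite: Giaquinta1984, Ch. III §1 p.70] -/
theorem sum_sq_sub_eq (f : Zd d → ℝ) (z : Zd d) (ρ : ℤ) (c : ℝ) :
    ∑ y ∈ box z ρ, (f y - c) ^ 2 = exc f z ρ + ((box z ρ).card : ℝ) * (boxAvg f z ρ - c) ^ 2 := by
  have h := sum_sub_boxAvg f z ρ
  set a := boxAvg f z ρ
  calc ∑ y ∈ box z ρ, (f y - c) ^ 2 = ∑ y ∈ box z ρ, ((f y - a) ^ 2 + 2 * (a - c) * (f y - a) + (a - c) ^ 2) :=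
        Finset.sum_congr rfl fun y _ => by ring
    _ = exc f z ρ + 2 * (a - c) * ∑ y ∈ box z ρ, (f y - a) + ((box z ρ).card : ℝ) * (a - c) ^ 2 := by
        rw [Finset.sum_add_distrib, Finset.sum_add_distrib, Finset.sum_const, nsmul_eq_mul, ← Finset.mul_sum, exc]
    _ = exc f z ρ + ((box z ρ).card : ℝ) * (a - c) ^ 2 := by rw [h]; ring

/-- **The mean minimises**: `exc f z ρ ≤ Σ_Q (f − c)²` for every constant `c`. [folklore] [cite: Giaquinta1984, Ch. III §1 p.70] -/
theorem exc_le_sum_sq_sub (f : Zd d → ℝ) (z : Zd d) (ρ : ℤ) (c : ℝ) : exc f z ρ ≤ ∑ y ∈ box z ρ, (f y - c) ^ 2 := by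
  rw [sum_sq_sub_eq]; nlinarith [sq_nonneg (boxAvg f z ρ - c), Nat.cast_nonneg (α := ℝ) (box z ρ).card]

/-- `exc f z ρ ≤ Σ_Q f²` (`c = 0`). [folklore] [cite: Giaquinta1984, Ch. III §1 p.70] -/
theorem exc_le_sum_sq (f : Zd d → ℝ) (z : Zd d) (ρ : ℤ) : exc f z ρ ≤ ∑ y ∈ box z ρ, f y ^ 2 := by
  simpa using exc_le_sum_sq_sub f z ρ 0

/-- **Monotonicity in the radius**: `exc f z ρ ≤ exc f z ρ′` for `ρ ≤ ρ′`. [folklore] [cite: Giaquinta1984, Ch. III §1 p.70] -/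
theorem exc_mono (f : Zd d → ℝ) (z : Zd d) {ρ ρ' : ℤ} (h : ρ ≤ ρ') : exc f z ρ ≤ exc f z ρ' :=
  calc exc f z ρ ≤ ∑ y ∈ box z ρ, (f y - boxAvg f z ρ') ^ 2 := exc_le_sum_sq_sub f z ρ _
    _ ≤ ∑ y ∈ box z ρ', (f y - boxAvg f z ρ') ^ 2 := Finset.sum_le_sum_of_subset_of_nonneg (box_mono z h) fun _ _ _ => sq_nonneg _
    _ = exc f z ρ' := rfl

/-- **Subadditivity**: `exc (f + g) ≤ 2 exc f + 2 exc g`. [folklore] [cite: Giaquinta1984, Ch. III §1 p.70] -/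
theorem exc_add_le (f g : Zd d → ℝ) (z : Zd d) (ρ : ℤ) : exc (fun y => f y + g y) z ρ ≤ 2 * exc f z ρ + 2 * exc g z ρ :=
  calc exc (fun y => f y + g y) z ρ ≤ ∑ y ∈ box z ρ, (f y + g y - (boxAvg f z ρ + boxAvg g z ρ)) ^ 2 := exc_le_sum_sq_sub _ z ρ _
    _ ≤ ∑ y ∈ box z ρ, (2 * (f y - boxAvg f z ρ) ^ 2 + 2 * (g y - boxAvg g z ρ) ^ 2) :=
        Finset.sum_le_sum fun y _ => by nlinarith [sq_nonneg ((f y - boxAvg f z ρ) - (g y - boxAvg g z ρ))]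
    _ = 2 * exc f z ρ + 2 * exc g z ρ := by rw [Finset.sum_add_distrib, ← Finset.mul_sum, ← Finset.mul_sum, exc, exc]

/-- The excess is unchanged by adding a constant. [folklore] [cite: Giaquinta1984, Ch. III §1 p.70] -/
theorem exc_add_const (f : Zd d → ℝ) (c : ℝ) (z : Zd d) (ρ : ℤ) : exc (fun y => f y + c) z ρ = exc f z ρ := by
  apply le_antisymm
  · calc exc (fun y => f y + c) z ρ ≤ ∑ y ∈ box z ρ, (f y + c - (boxAvg f z ρ + c)) ^ 2 := exc_le_sum_sq_sub _ z ρ _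
      _ = exc f z ρ := by rw [exc]; exact Finset.sum_congr rfl fun y _ => by ring
  · calc exc f z ρ ≤ ∑ y ∈ box z ρ, (f y - (boxAvg (fun y => f y + c) z ρ - c)) ^ 2 := exc_le_sum_sq_sub f z ρ _
      _ = exc (fun y => f y + c) z ρ := by rw [exc]; exact Finset.sum_congr rfl fun y _ => by ring

/-- One term of the sum: `(f x − boxAvg f z ρ)² ≤ exc f z ρ` for `x ∈ Q_ρ(z)`. [folklore] [cite: Giaquinta1984, Ch. III §1 p.70] -/
theorem sq_sub_boxAvg_le_exc (f : Zd d → ℝ) {z x : Zd d} {ρ : ℤ} (hx : x ∈ box z ρ) : (f x - boxAvg f z ρ) ^ 2 ≤ exc f z ρ :=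
  Finset.single_le_sum (f := fun y => (f y - boxAvg f z ρ) ^ 2) (fun _ _ => sq_nonneg _) hx

/-- **Nested boxes**: for `Q′ = Q_{ρ′}(z′) ⊆ Q = Q_ρ(z)`, `#Q′·(boxAvg_{Q′} f − boxAvg_Q f)² ≤ exc_Q f` (Jensen on `Q′`, then enlarge the sum).
[folklore] [cite: Giaquinta1984, Ch. III §1 Lemma 1.1 p.70] -/
theorem card_mul_sq_sub_le_exc (f : Zd d → ℝ) {z z' : Zd d} {ρ ρ' : ℤ} (hsub : box z' ρ' ⊆ box z ρ) :
    ((box z' ρ').card : ℝ) * (boxAvg f z' ρ' - boxAvg f z ρ) ^ 2 ≤ exc f z ρ := by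
  set c := boxAvg f z ρ
  by_cases hc : ((box z' ρ').card : ℝ) = 0
  · rw [hc, zero_mul]; exact exc_nonneg f z ρ
  have hcpos : 0 < ((box z' ρ').card : ℝ) := lt_of_le_of_ne (Nat.cast_nonneg _) (Ne.symm hc)
  have havg : boxAvg f z' ρ' - c = (∑ y ∈ box z' ρ', (f y - c)) / ((box z' ρ').card : ℝ) := by
    rw [boxAvg, Finset.sum_sub_distrib, Finset.sum_const, nsmul_eq_mul, sub_div, mul_div_cancel_left₀ _ hc]
  have hJ : (∑ y ∈ box z' ρ', (f y - c)) ^ 2 ≤ ((box z' ρ').card : ℝ) * ∑ y ∈ box z' ρ', (f y - c) ^ 2 :=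
    sq_sum_le_card_mul_sum_sq
  calc ((box z' ρ').card : ℝ) * (boxAvg f z' ρ' - c) ^ 2 = (∑ y ∈ box z' ρ', (f y - c)) ^ 2 / ((box z' ρ').card : ℝ) := by
        rw [havg, div_pow]; field_simp
    _ ≤ ∑ y ∈ box z' ρ', (f y - c) ^ 2 := by rw [div_le_iff₀ hcpos]; linarith
    _ ≤ ∑ y ∈ box z ρ, (f y - c) ^ 2 := Finset.sum_le_sum_of_subset_of_nonneg hsub fun _ _ _ => sq_nonneg _
    _ = exc f z ρ := by rw [sum_sq_sub_eq, sub_self]; ring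

/-- Jensen: `#Q·(boxAvg_Q f)² ≤ Σ_Q f²`. [folklore] [cite: Giaquinta1984, Ch. III §1 p.70] -/
theorem card_mul_boxAvg_sq_le (f : Zd d → ℝ) (z : Zd d) (ρ : ℤ) : ((box z ρ).card : ℝ) * boxAvg f z ρ ^ 2 ≤ ∑ y ∈ box z ρ, f y ^ 2 := by
  by_cases hc : ((box z ρ).card : ℝ) = 0
  · rw [hc, zero_mul]; exact Finset.sum_nonneg fun _ _ => sq_nonneg _
  have hcpos : 0 < ((box z ρ).card : ℝ) := lt_of_le_of_ne (Nat.cast_nonneg _) (Ne.symm hc)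
  have hJ : (∑ y ∈ box z ρ, f y) ^ 2 ≤ ((box z ρ).card : ℝ) * ∑ y ∈ box z ρ, f y ^ 2 := sq_sum_le_card_mul_sum_sq
  calc ((box z ρ).card : ℝ) * boxAvg f z ρ ^ 2 = (∑ y ∈ box z ρ, f y) ^ 2 / ((box z ρ).card : ℝ) := by rw [boxAvg, div_pow]; field_simp
    _ ≤ ∑ y ∈ box z ρ, f y ^ 2 := by rw [div_le_iff₀ hcpos]; linarith

/-! ## §2 Lattice paths: differences controlled by the sup of the forward differences -/

/-- `update q j (t+1) = update q j t + e_j`. [folklore] [cite: Giaquinta1984, Ch. III §1 p.70] -/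
theorem update_succ_eq_add_unitVec (q : Zd d) (j : Fin d) (t : ℤ) :
    Function.update q j (t + 1) = Function.update q j t + unitVec j := by
  funext i
  by_cases h : i = j
  · subst h; simp [unitVec]
  · simp [Function.update_of_ne h, unitVec, Pi.single_eq_of_ne h]

/-- ONE COORDINATE: if `update q j t ∈ Q_ρ(x)` for all `a ≤ t ≤ a + n` and `|∂_νv| ≤ S` on `Q_ρ(x)`, then
`|v(update q j (a+n)) − v(update q j a)| ≤ n·S`. [folklore] [cite: Giaquinta1984, Ch. III §1 p.70] -/
theorem abs_sub_update_le (v : Zd d → ℝ) {x : Zd d} {ρ : ℤ} {S : ℝ} (hS : ∀ y ∈ box x ρ, ∀ ν, |fdiff ν v y| ≤ S)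
    (q : Zd d) (j : Fin d) (a : ℤ) :
    ∀ n : ℕ, (∀ t : ℤ, a ≤ t → t ≤ a + n → Function.update q j t ∈ box x ρ) →
      |v (Function.update q j (a + n)) - v (Function.update q j a)| ≤ n * S := by
  intro n
  induction n with
  | zero => intro _; simp
  | succ n ih =>
    intro hmem
    have ih' := ih fun t h1 h2 => hmem t h1 (by push_cast; linarith)
    have hin : Function.update q j (a + n) ∈ box x ρ := hmem (a + n) (by linarith) (by push_cast; linarith)
    have e : Function.update q j (a + ((n + 1 : ℕ) : ℤ)) = Function.update q j (a + n) + unitVec j := by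
      rw [← update_succ_eq_add_unitVec]; push_cast; ring_nf
    have hstep : |v (Function.update q j (a + ((n + 1 : ℕ) : ℤ))) - v (Function.update q j (a + n))| ≤ S := by
      have := hS _ hin j
      rwa [fdiff_apply, ← e] at this
    calc |v (Function.update q j (a + ((n + 1 : ℕ) : ℤ))) - v (Function.update q j a)|
        = |(v (Function.update q j (a + ((n + 1 : ℕ) : ℤ))) - v (Function.update q j (a + n))) +
            (v (Function.update q j (a + n)) - v (Function.update q j a))| := by ring_nf
      _ ≤ S + n * S := (abs_add_le _ _).trans (add_le_add hstep ih')
      _ = ((n + 1 : ℕ) : ℝ) * S := by push_cast; ring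

/-- ONE COORDINATE, both orientations: if `update q j t ∈ Q_ρ(x)` for all `t` between `s` and `s′`, then
`|v(update q j s′) − v(update q j s)| ≤ |s′ − s|·S`. [folklore] [cite: Giaquinta1984, Ch. III §1 p.70] -/
theorem abs_sub_update_le' (v : Zd d → ℝ) {x : Zd d} {ρ : ℤ} {S : ℝ} (hS : ∀ y ∈ box x ρ, ∀ ν, |fdiff ν v y| ≤ S)
    (q : Zd d) (j : Fin d) {s s' : ℤ} (hseg : ∀ t : ℤ, min s s' ≤ t → t ≤ max s s' → Function.update q j t ∈ box x ρ) :
    |v (Function.update q j s') - v (Function.update q j s)| ≤ |((s' : ℤ) : ℝ) - s| * S := by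
  rcases le_total s s' with h | h
  · obtain ⟨n, hn⟩ : ∃ n : ℕ, s' = s + n := ⟨(s' - s).toNat, by rw [Int.toNat_of_nonneg (by linarith)]; ring⟩
    have key := abs_sub_update_le v hS q j s n fun t h1 h2 =>
      hseg t (by rw [min_eq_left h]; exact h1) (by rw [max_eq_right h, hn]; exact h2)
    rw [← hn] at key
    have habs : |((s' : ℤ) : ℝ) - s| = n := by
      rw [hn]; push_cast; rw [show (s : ℝ) + n - s = n by ring, Nat.abs_cast]
    rwa [habs]
  · obtain ⟨n, hn⟩ : ∃ n : ℕ, s = s' + n := ⟨(s - s').toNat, by rw [Int.toNat_of_nonneg (by linarith)]; ring⟩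
    have key := abs_sub_update_le v hS q j s' n fun t h1 h2 =>
      hseg t (by rw [min_eq_right h]; exact h1) (by rw [max_eq_left h, hn]; exact h2)
    rw [← hn, abs_sub_comm] at key
    have habs : |((s' : ℤ) : ℝ) - s| = n := by
      rw [hn]; push_cast; rw [show (s' : ℝ) - (s' + n) = -(n : ℝ) by ring, abs_neg, Nat.abs_cast]
    rwa [habs]

/-- The interpolating points of the coordinate path from `x` to `y`: the first `k` coordinates are those of `y`, the rest those of `x`.
[folklore] [cite: Giaquinta1984, Ch. III §1 p.70] -/
def pathPt (x y : Zd d) (k : ℕ) : Zd d := fun i => if (i : ℕ) < k then y i else x i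

/-- `pathPt x y 0 = x`. [folklore] [cite: Giaquinta1984, Ch. III §1 p.70] -/
theorem pathPt_zero (x y : Zd d) : pathPt x y 0 = x := by funext i; simp [pathPt]

/-- `pathPt x y d = y`. [folklore] [cite: Giaquinta1984, Ch. III §1 p.70] -/
theorem pathPt_self (x y : Zd d) : pathPt x y d = y := by funext i; simp [pathPt, i.is_lt]

/-- The `k`-th step changes coordinate `k` only: `pathPt x y (k+1) = update (pathPt x y k) k (y k)` and `pathPt x y k = update (pathPt x y k) k (x k)`.
[folklore] [cite: Giaquinta1984, Ch. III §1 p.70] -/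
theorem pathPt_succ (x y : Zd d) (k : Fin d) :
    pathPt x y (k + 1) = Function.update (pathPt x y k) k (y k) ∧ pathPt x y k = Function.update (pathPt x y k) k (x k) := by
  constructor
  · funext i
    by_cases h : i = k
    · subst h; simp [pathPt]
    · have hne : (i : ℕ) ≠ k := fun e => h (Fin.ext e)
      simp only [pathPt, Function.update_of_ne h]
      by_cases hlt : (i : ℕ) < k
      · simp [hlt, show (i : ℕ) < k + 1 by omega]
      · simp [hlt, show ¬ (i : ℕ) < k + 1 by omega]
  · funext i
    by_cases h : i = k
    · subst h; simp [pathPt]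
    · simp only [Function.update_of_ne h]

/-- Every point `update (pathPt x y k) k t` with `t` between `x k` and `y k` lies in `Q_ρ(x)` when `y ∈ Q_ρ(x)`.
[folklore] [cite: Giaquinta1984, Ch. III §1 p.70] -/
theorem update_pathPt_mem_box {x y : Zd d} {ρ : ℤ} (hy : y ∈ box x ρ) (k : Fin d) {t : ℤ}
    (h1 : min (x k) (y k) ≤ t) (h2 : t ≤ max (x k) (y k)) : Function.update (pathPt x y k) k t ∈ box x ρ := by
  rw [mem_box] at hy ⊢
  have hρ : 0 ≤ ρ := (abs_nonneg _).trans (hy k)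
  intro i
  by_cases h : i = k
  · subst h
    simp only [Function.update_self]
    have := hy i
    rw [abs_le] at this ⊢
    constructor
    · have := min_le_iff.1 h1; rcases le_total (x i) (y i) with hh | hh
      · rw [min_eq_left hh] at h1; linarith
      · rw [min_eq_right hh] at h1; linarith
    · rcases le_total (x i) (y i) with hh | hh
      · rw [max_eq_right hh] at h2; linarith
      · rw [max_eq_left hh] at h2; linarith
  · rw [Function.update_of_ne h]
    simp only [pathPt]
    by_cases hlt : (i : ℕ) < k
    · simp only [hlt, if_true]; exact hy i
    · simp only [hlt, if_false, sub_self, abs_zero]; exact hρ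

/-- **LATTICE PATHS**: if `|∂_νv| ≤ S` on `Q_ρ(x)` (all `ν`) then `|v y − v x| ≤ d·ρ·S` for every `y ∈ Q_ρ(x)` (change the coordinates of `x` into
those of `y` one at a time; every intermediate point lies in `Q_ρ(x)` and each coordinate costs `|y_k − x_k|·S ≤ ρ S`).
[folklore] [cite: Giaquinta1984, Ch. III §1 p.70] -/
theorem abs_sub_le_of_fdiff_bound (v : Zd d → ℝ) {x : Zd d} {ρ : ℤ} {S : ℝ} (hS0 : 0 ≤ S)
    (hS : ∀ y ∈ box x ρ, ∀ ν, |fdiff ν v y| ≤ S) {y : Zd d} (hy : y ∈ box x ρ) : |v y - v x| ≤ d * ρ * S := by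
  have hyi := mem_box.1 hy
  -- by induction on the number of coordinates already moved
  have main : ∀ k : ℕ, k ≤ d → |v (pathPt x y k) - v x| ≤ k * ρ * S := by
    intro k
    induction k with
    | zero => intro _; rw [pathPt_zero, sub_self, abs_zero]; simp
    | succ k ih =>
      intro hk
      have hk' : k < d := by omega
      set kk : Fin d := ⟨k, hk'⟩
      obtain ⟨e1, e2⟩ := pathPt_succ x y kk
      have hstep : |v (pathPt x y (k + 1)) - v (pathPt x y k)| ≤ ρ * S := by
        have h := abs_sub_update_le' v hS (pathPt x y k) kk (s := x kk) (s' := y kk)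
          fun t h1 h2 => update_pathPt_mem_box hy kk h1 h2
        rw [← e1, ← e2] at h
        refine h.trans (mul_le_mul_of_nonneg_right ?_ hS0)
        have := hyi kk
        have : (((|y kk - x kk| : ℤ)) : ℝ) ≤ ρ := by exact_mod_cast this
        rwa [Int.cast_abs, Int.cast_sub] at this
      calc |v (pathPt x y (k + 1)) - v x| = |(v (pathPt x y (k + 1)) - v (pathPt x y k)) + (v (pathPt x y k) - v x)| := by ring_nf
        _ ≤ ρ * S + k * ρ * S := (abs_add_le _ _).trans (add_le_add hstep (ih hk'.le))
        _ = ((k + 1 : ℕ) : ℝ) * ρ * S := by push_cast; ring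
  have := main d le_rfl
  rwa [pathPt_self] at this

end Literature.MathematicalPhysics.QuantumFieldTheory.Balaban1983to89.B4Eq19LatticeBoxMeans

end
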